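import Summits.ABC.ABC.Theses.DefiniteXi
import HarnessLib

/-!
# Stub-ideation k2, generation 11 (FAMILY 2 — RESHAPE) — `stub_primeToSixDegreeBound` (P6)
# crux `DefiniteXi.SteinbergCore` (stmt-ABC-15024), line `p6_tamagawa_split` (sha cda023e8)

Elaboration companion of `STUB-IDEAS-stub_primeToSixDegreeBound-2.md` (gen 11, TERMINAL for Family 2).
Gens 2–10 of this seat (`…StubIdeas2G2 … G10`) stand by reference; this file types the ONE new cell of
gen 11 and its assembly, sorry-free, importing only the route file:

**R1 — regime split by 6-smoothness of ONE odd valuation ("five-full escape").**  For a Frey triple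
`(a, b)` call an odd prime `q ∣ ab(a+b)` SMOOTH when the prime-to-6 part of `v_q(ab(a+b))` is `1`
(equivalently of `v_q(Δ_min E) = 2 v_q(ab(a+b))`, tree
`Literature.NumberTheory.Automorphic.factorization_minimalDiscriminantNorm_freyCurve_of_ne_two`).  At a smooth
prime Takahashi's exact identity `deg P⋆ · i = ξ(N/q; q) · j`, `i j = v_q(Δ_min W⋆)` (fact
`takahashi2001_thm_2_3_of_coprime`) has `cps i, cps j ≤ 163` after the Pasten transports, so the degree
currency and the Brandt currency agree UP TO AN ABSOLUTE CONSTANT and WITHOUT the Tamagawa factor `T`: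

* `CpsDegLeXiOnSmooth`  (piece A, PROVABLE from the four named inputs of
  `Summit.ABC.ABC.Theorems.xiDegreeComparison_prime_of_facts`, same pivots; K = 4·163³);
* `CpsXiLeDegOnSmooth`  (piece A′, the converse direction, same proof, K = 4·163³);
* `CpsXiBoundOnSmooth`  (piece B = the route's prime-rung Brandt atom `B♭` with `T` DROPPED, restricted to
  smooth primes — abc-generic, NOT staffable: see the .md);
* `StubOnFiveFull`      (piece C = the stub on the complementary regime: every odd prime of `ab(a+b)` has a
  valuation with a prime factor `≥ 5`, in particular `≥ 5` — an Erdős–Mollin–Walsh-type family;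
  `⟸ FiveFullFinite`, open, implied by abc with any exponent `< 5/3`);
* `stub_of_split : CpsDegLeXiOnSmooth → CpsXiBoundOnSmooth → StubOnFiveFull → Stub` and the converses
  `stubOnFiveFull_of_stub`, `cpsXiBoundOnSmooth_of_stub` (so, modulo the provable calibration A/A′ and the
  existence of a minimal datum, `Stub ⟺ CpsXiBoundOnSmooth ∧ StubOnFiveFull`).

Structural by-product for the line: the `T³` loss of child 1 (`stub_xiDegreeComparison`) and the whole of
child 3 (`stub_abcValuationProduct`, abc-strength) are FIVE-FULL-REGIME artefacts — at a smooth prime the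
comparison is `T`-free in both directions.
-/

set_option linter.dupNamespace false

noncomputable section

namespace Summit.ABC.ABC.Cruxes.SteinbergCore.StubIdeas2G11

open Literature.NumberTheory.EllipticCurves Literature.NumberTheory.EllipticCurves.ModularForms
open Literature.NumberTheory.DiophantineGeometry Literature.NumberTheory.Automorphic
open Summit.ABC.ABC.Theses.DefiniteXi

/-- The prime-to-`6` part `cps n = n / (2^{v₂ n} 3^{v₃ n})`, written exactly as in the route decl
(junk-free API: `Summit.ABC.ABC.Theorems.SteinbergCore.Negative.primeToSix_mul`, `one_le_primeToSix_iff`,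
`primeToSix_le_primeToSix_mul`, file `Theorems/SteinbergCore/Negative/SteinbergCoreDomain.lean`). [folklore] -/
def cps (n : ℕ) : ℕ := n / (ordProj[2] n * ordProj[3] n)

/-- The registered stub `stub_primeToSixDegreeBound` of `Lines/p6_tamagawa_split.lean`, verbatim. [folklore] -/
def Stub : Prop :=
  ∀ ε : ℝ, 0 < ε → ∃ C : ℝ, ∀ a b : ℤ, IsCoprime a b → a * b * (a + b) ≠ 0 → ∀ (N : ℕ) [NeZero N],
    (Literature.NumberTheory.EllipticCurves.freyCurve a b).conductorNorm ℤ = N →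
    ∀ D : Literature.NumberTheory.EllipticCurves.ModularForms.ModularParametrizationData
      (Literature.NumberTheory.EllipticCurves.freyCurve a b) N,
      (∀ D' : Literature.NumberTheory.EllipticCurves.ModularForms.ModularParametrizationData
        (Literature.NumberTheory.EllipticCurves.freyCurve a b) N, D.deg ≤ D'.deg) →
      ((D.deg / (ordProj[2] D.deg * ordProj[3] D.deg) : ℕ) : ℝ) ≤ C * (N : ℝ) ^ (2 + ε)

/-! ### R1 — the regime and the four pieces -/

/-- **The smooth regime.** Some odd prime `q` of `ab(a+b)` has a valuation whose prime-to-`6` part is `1`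
(`v_q(ab(a+b)) ∈ {1,2,3,4,6,8,9,12,16,…}`); since `v_q(Δ_min E_{a,b}) = 2 v_q(ab(a+b))` this is
`cps (v_q Δ_min) = 1`.  Its negation is the FIVE-FULL regime: every odd prime of `ab(a+b)` occurs to a power
divisible by a prime `≥ 5`. [folklore] -/
def HasSmoothOddPrime (a b : ℤ) : Prop :=
  ∃ q : ℕ, q.Prime ∧ q ≠ 2 ∧ (q : ℤ) ∣ a * b * (a + b) ∧
    cps (padicValNat q (a * b * (a + b)).natAbs) = 1

/-- **Piece A (PROVABLE, one prover cycle): degree side `≤ K ·` Brandt side at a smooth prime, `T`-free.**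
For a minimal datum `D` of the Frey model and a smooth odd prime `q` of the conductor,
`cps (deg D) ≤ K · cps ξ(N/q; q)` with an absolute `K` (`= 4·163³` from the tree's pivots: `deg D = δ₀ m_E`,
`deg P⋆ = δ₀ m⋆`, `m⋆ ≤ m_E ≤ 4·163`, Takahashi `deg P⋆ · i = ξ · j`, `i j = c_q(W⋆)`, and
`cps c_q(W⋆) ≤ 163 · cps c_q(E) = 163` by Pasten's Lemma 6.8, whence `cps j ≤ 163` and
`cps δ₀ ≤ cps (δ₀ m⋆) = cps ξ · cps j / cps i ≤ 163 cps ξ`).  Inputs by name: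
`takahashi2001_thm_2_3_of_coprime`, `PastenShimura2024_minimalDegree_le_163_mul`, `PastenShimura2024_lemma_6_8`,
`FreyModularity` — exactly those of `Summit.ABC.ABC.Theorems.xiDegreeComparison_prime_of_facts`.
[cite: Takahashi2001, Thm. 2.3 (p. 79)] [cite: PastenShimura2024, §3 p. 13, Lemma 6.8 (p. 22)] -/
def CpsDegLeXiOnSmooth : Prop :=
  ∃ K : ℕ, ∀ a b : ℤ, IsCoprime a b → a * b * (a + b) ≠ 0 → ∀ (N : ℕ) [NeZero N],
    (freyCurve a b).conductorNorm ℤ = N →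
    ∀ q : ℕ, q.Prime → q ≠ 2 → (q : ℤ) ∣ a * b * (a + b) →
      cps (padicValNat q (a * b * (a + b)).natAbs) = 1 →
    ∀ D : ModularParametrizationData (freyCurve a b) N,
      (∀ D' : ModularParametrizationData (freyCurve a b) N, D.deg ≤ D'.deg) →
      cps D.deg ≤ K * cps (brandtXi (N / q) q (fun n => (freyCurve a b).LFunction n))

/-- **Piece A′ (PROVABLE, same cycle): Brandt side `≤ K ·` degree side at a smooth prime, `T`-free** — the
smooth-regime sharpening of child 1 `stub_xiDegreeComparison` at prime type (there: `· N^ε · T³`):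
`cps ξ · cps j = cps (deg P⋆) · cps i`, `cps i ≤ 163`, `cps (deg P⋆) = cps δ₀ · cps m⋆ ≤ 4·163 · cps (deg D)`.
[cite: Takahashi2001, Thm. 2.3 (p. 79)] [cite: PastenShimura2024, §3 p. 13, Lemma 6.8 (p. 22)] -/
def CpsXiLeDegOnSmooth : Prop :=
  ∃ K : ℕ, ∀ a b : ℤ, IsCoprime a b → a * b * (a + b) ≠ 0 → ∀ (N : ℕ) [NeZero N],
    (freyCurve a b).conductorNorm ℤ = N →
    ∀ q : ℕ, q.Prime → q ≠ 2 → (q : ℤ) ∣ a * b * (a + b) →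
      cps (padicValNat q (a * b * (a + b)).natAbs) = 1 →
    ∀ D : ModularParametrizationData (freyCurve a b) N,
      (∀ D' : ModularParametrizationData (freyCurve a b) N, D.deg ≤ D'.deg) →
      cps (brandtXi (N / q) q (fun n => (freyCurve a b).LFunction n)) ≤ K * cps D.deg

/-- **Piece B (OPEN — the prime-rung Brandt atom `B♭` with `T` dropped, on smooth primes only).**
`cps ξ(E_{a,b}; N/q, q) ≤ C_ε N^{2+ε}` at every SMOOTH odd prime `q` of the conductor.  By A/A′ it is
EQUIVALENT to the stub restricted to the smooth regime, hence (k1 g2 `StubIdeas1G2.p6_of_ABC_of_facts` /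
calibration `steinbergCore_iff_freyDegreeBound_of_items'`) abc-complete on the generic family of triples:
recorded, not staffable. [folklore] -/
def CpsXiBoundOnSmooth : Prop :=
  ∀ ε : ℝ, 0 < ε → ∃ C : ℝ, ∀ a b : ℤ, IsCoprime a b → a * b * (a + b) ≠ 0 → ∀ (N : ℕ) [NeZero N],
    (freyCurve a b).conductorNorm ℤ = N →
    ∀ q : ℕ, q.Prime → q ≠ 2 → (q : ℤ) ∣ a * b * (a + b) →
      cps (padicValNat q (a * b * (a + b)).natAbs) = 1 →
      ((cps (brandtXi (N / q) q (fun n => (freyCurve a b).LFunction n)) : ℕ) : ℝ) ≤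
        C * (N : ℝ) ^ (2 + ε)

/-- **Piece C (OPEN — the stub on the five-full regime).**  The registered stub restricted to Frey triples
with NO smooth odd prime (odd parts of `a`, `b`, `a+b` all `5`-full in the strong sense `cps v_q ≠ 1`).
Implied by `FiveFullFinite` (finitely many such coprime triples: then `C` is a finite maximum), which abc
with any exponent `< 5/3` gives and which is open unconditionally (no such triple with three odd parts `> 1`
is known; `1 + 2^k` five-full is already open). [folklore] -/
def StubOnFiveFull : Prop :=
  ∀ ε : ℝ, 0 < ε → ∃ C : ℝ, ∀ a b : ℤ, IsCoprime a b → a * b * (a + b) ≠ 0 → ¬ HasSmoothOddPrime a b →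
    ∀ (N : ℕ) [NeZero N], (freyCurve a b).conductorNorm ℤ = N →
    ∀ D : ModularParametrizationData (freyCurve a b) N,
      (∀ D' : ModularParametrizationData (freyCurve a b) N, D.deg ≤ D'.deg) →
      ((cps D.deg : ℕ) : ℝ) ≤ C * (N : ℝ) ^ (2 + ε)

/-- **The Erdős–Mollin–Walsh-type finiteness statement behind piece C** (OPEN; abc with exponent `5/3 − δ`
implies it: `rad(abc) ≤ 2 · (odd part of abc)^{1/5} ≤ 2 c^{3/5}`). [folklore] -/
def FiveFullFinite : Prop :=
  {p : ℤ × ℤ | IsCoprime p.1 p.2 ∧ p.1 * p.2 * (p.1 + p.2) ≠ 0 ∧ ¬ HasSmoothOddPrime p.1 p.2}.Finite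

/-! ### Assembly and converses (kernel-checked) -/

/-- **R1 assembly: the three pieces give the registered stub** (`C := max (K C₁) C₂`; case split on the
regime; at a smooth prime `cps (deg D) ≤ K cps ξ ≤ K C₁ N^{2+ε}`). [folklore] -/
theorem stub_of_split (hA : CpsDegLeXiOnSmooth) (hB : CpsXiBoundOnSmooth) (hC : StubOnFiveFull) :
    Stub := by
  obtain ⟨K, hK⟩ := hA
  intro ε hε
  obtain ⟨C₁, hC₁⟩ := hB ε hε
  obtain ⟨C₂, hC₂⟩ := hC ε hε
  refine ⟨max ((K : ℝ) * C₁) C₂, fun a b hab h0 N _ hN D hDmin => ?_⟩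
  have hNpow : (0 : ℝ) ≤ (N : ℝ) ^ (2 + ε) := Real.rpow_nonneg (Nat.cast_nonneg N) _
  by_cases hs : HasSmoothOddPrime a b
  · obtain ⟨q, hq, hq2, hqd, hsm⟩ := hs
    have h1 : cps D.deg ≤ K * cps (brandtXi (N / q) q (fun n => (freyCurve a b).LFunction n)) :=
      hK a b hab h0 N hN q hq hq2 hqd hsm D hDmin
    have h1' : ((cps D.deg : ℕ) : ℝ) ≤
        (K : ℝ) * ((cps (brandtXi (N / q) q (fun n => (freyCurve a b).LFunction n)) : ℕ) : ℝ) := by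
      exact_mod_cast h1
    have h2 := hC₁ a b hab h0 N hN q hq hq2 hqd hsm
    calc ((D.deg / (ordProj[2] D.deg * ordProj[3] D.deg) : ℕ) : ℝ)
        = ((cps D.deg : ℕ) : ℝ) := rfl
      _ ≤ (K : ℝ) * ((cps (brandtXi (N / q) q (fun n => (freyCurve a b).LFunction n)) : ℕ) : ℝ) := h1'
      _ ≤ (K : ℝ) * (C₁ * (N : ℝ) ^ (2 + ε)) := mul_le_mul_of_nonneg_left h2 (Nat.cast_nonneg K)
      _ = ((K : ℝ) * C₁) * (N : ℝ) ^ (2 + ε) := by ring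
      _ ≤ max ((K : ℝ) * C₁) C₂ * (N : ℝ) ^ (2 + ε) :=
          mul_le_mul_of_nonneg_right (le_max_left _ _) hNpow
  · have h2 : ((cps D.deg : ℕ) : ℝ) ≤ C₂ * (N : ℝ) ^ (2 + ε) := hC₂ a b hab h0 hs N hN D hDmin
    calc ((D.deg / (ordProj[2] D.deg * ordProj[3] D.deg) : ℕ) : ℝ)
        = ((cps D.deg : ℕ) : ℝ) := rfl
      _ ≤ C₂ * (N : ℝ) ^ (2 + ε) := h2
      _ ≤ max ((K : ℝ) * C₁) C₂ * (N : ℝ) ^ (2 + ε) :=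
          mul_le_mul_of_nonneg_right (le_max_right _ _) hNpow

/-- Converse 1 (trivial): the stub gives piece C. [folklore] -/
theorem stubOnFiveFull_of_stub (h : Stub) : StubOnFiveFull := by
  intro ε hε
  obtain ⟨C, hC⟩ := h ε hε
  exact ⟨C, fun a b hab h0 _ N _ hN D hDmin => hC a b hab h0 N hN D hDmin⟩

/-- Converse 2: the stub and the provable calibration A′ give piece B, granted a minimal datum of the Frey
model exists (`FreyModularity` + well-ordering of `ℕ`; hypothesis `hex` in the shape used by k2 g10's
`abc_of_maninHeightCredit`).  With `stub_of_split`: `Stub ⟺ CpsXiBoundOnSmooth ∧ StubOnFiveFull` modulo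
A, A′, `hex`. [folklore] -/
theorem cpsXiBoundOnSmooth_of_stub (hA' : CpsXiLeDegOnSmooth)
    (hex : ∀ a b : ℤ, IsCoprime a b → a * b * (a + b) ≠ 0 → ∀ (N : ℕ) [NeZero N],
      (freyCurve a b).conductorNorm ℤ = N →
      ∃ D : ModularParametrizationData (freyCurve a b) N,
        ∀ D' : ModularParametrizationData (freyCurve a b) N, D.deg ≤ D'.deg)
    (h : Stub) : CpsXiBoundOnSmooth := by
  obtain ⟨K, hK⟩ := hA'
  intro ε hε
  obtain ⟨C, hC⟩ := h ε hε
  refine ⟨(K : ℝ) * C, fun a b hab h0 N _ hN q hq hq2 hqd hsm => ?_⟩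
  obtain ⟨D, hDmin⟩ := hex a b hab h0 N hN
  have h1 : cps (brandtXi (N / q) q (fun n => (freyCurve a b).LFunction n)) ≤ K * cps D.deg :=
    hK a b hab h0 N hN q hq hq2 hqd hsm D hDmin
  have h1' : ((cps (brandtXi (N / q) q (fun n => (freyCurve a b).LFunction n)) : ℕ) : ℝ) ≤
      (K : ℝ) * ((cps D.deg : ℕ) : ℝ) := by exact_mod_cast h1
  have h2 : ((cps D.deg : ℕ) : ℝ) ≤ C * (N : ℝ) ^ (2 + ε) := hC a b hab h0 N hN D hDmin
  calc ((cps (brandtXi (N / q) q (fun n => (freyCurve a b).LFunction n)) : ℕ) : ℝ)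
      ≤ (K : ℝ) * ((cps D.deg : ℕ) : ℝ) := h1'
    _ ≤ (K : ℝ) * (C * (N : ℝ) ^ (2 + ε)) := mul_le_mul_of_nonneg_left h2 (Nat.cast_nonneg K)
    _ = (K : ℝ) * C * (N : ℝ) ^ (2 + ε) := by ring

/-- Piece C from the finiteness statement is elementary (finite maximum of `cps (deg D_min) / N^{2+ε}` over
the finite set, `N ≥ 1`); left to the prover as helper `stubOnFiveFull_of_finite` (signature in the .md).
Sanity only: the five-full regime is non-empty (`(a, b) = (1, 1)`: `ab(a+b) = 2` has no odd prime). [folklore] -/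
example : ¬ HasSmoothOddPrime 1 1 := by
  rintro ⟨q, hq, hq2, hqd, -⟩
  have h2 : (q : ℤ) ∣ 2 := by simpa using hqd
  have hq' : q ∣ 2 := by exact_mod_cast h2
  have := (Nat.prime_dvd_prime_iff_eq hq Nat.prime_two).mp hq'
  exact hq2 this

end Summit.ABC.ABC.Cruxes.SteinbergCore.StubIdeas2G11

end
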